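import Mathlib
import Summits.Langlands.Langlands.Theorems.SkinnerWilesDefectOneStrongLiftingAllFiniteLFactorRigidity
import Summits.Langlands.Langlands.Theorems.SkinnerWilesDefectOneStrongLiftingAllFinitePrimeSeparation

/-!
# The ramified-clause certificate: from the finite Euler-product identity at the integers to
# `t_{P,w₀} = t_{π,v₀}` — gluing prime separation and single-prime rigidity
# (item stmt-Langlands-15194 `StrongLiftingAllFinite`, route `SkinnerWilesDefectOne`)

Third and last file of the algebraic kernel of the L-function line for the RAMIFIED clause (R) of
`StrongLiftingAllFinite` (siblings `…LFactorRigidity`, `…PrimeSeparation`).  It packages the two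
halves into the single statement the automorphic half of the line has to reach, for `F = ℚ` (the
instance the route consumes; every finite place is then its own rational prime):

`ramified_clause_certificate` — **data**: pairwise distinct rational primes `p_i` (`i ∈ ι`, the
primes of `S = Ram(π) ∪ Ram(E/ℚ)`), a distinguished `i₀` (the ramified prime, `q = p_{i₀}`), the
Satake parameter `α` of `π_q` (non-zero entries, no two with ratio `q` — genericity), the
Euler-factor data `(u_j, m_j)_{j ∈ J}` of the lift at the place `w₀ ∣ q` (`L(s, P_{w₀}) =
∏_j (1 - u_j q^{-s})⁻¹`, `L(s, P̃_{w₀}) = ∏_j (1 - u_j⁻¹ q^{-(m_j-1)} q^{-s})⁻¹`, `u_j ≠ 0`,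
`m_j ≥ 1`), and at every other bad prime arbitrary Laurent data `G_i(x) x^{-d_i}`, `G'_i(x) x^{-d'_i}`
(`G_i, G'_i ∈ ℂ[X]` non-zero: the uncontrolled local quotients there, cleared of denominators, with
the conductor powers), monomials `x^{e₀}`, `x^{e₀'}` at `q` and a global constant `c₁` (root numbers
and conductors).  **Hypothesis**: for every integer `k ≥ k₀`, with `x_i = p_i^{-k}`,

  `∏_{a ∈ α} (1 - a x₀) · ∏_j (1 - (u_j q^{m_j} x₀)⁻¹) · x₀^{e₀} · ∏_{i ≠ i₀} G_i(x_i) x_i^{-d_i}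
     = c₁ · ∏_{a ∈ α} (1 - (a q x₀)⁻¹) · ∏_j (1 - u_j x₀) · x₀^{e₀'} · ∏_{i ≠ i₀} G'_i(x_i) x_i^{-d'_i}`

— the quotient of the functional equations of `Λ(s, P)` and `∏_i Λ(s, π ⊗ ηⁱ)` at `s = k`, the
factor at `q` written out (`L(s, π_q ⊗ η_qⁱ) = 1` for `i ≠ 0`, `η_q` being ramified; the dual
factors at `1 - s` give the terms in `(· x₀)⁻¹` since `q^{-(1-k)} = q⁻¹ x₀⁻¹`), cross-multiplied by
the two denominators.  **Conclusion**: every `m_j = 1` and `α = {u_j}_j` — the lift is unramified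
at `w₀` with Satake parameter `α`, clause (R) at `q`.

Proof: clear the inverses by the common non-zero factor `∏_j (-u_j q^{m_j} x₀) ∏_a (-a q x₀)
∏_{i ≠ i₀} x_i^{d_i + d'_i}`, obtaining a polynomial identity `∏_i φ_i(x_i) = c₁ ∏_i ψ_i(x_i)`;
`prime_separation` isolates `i₀`: `φ_{i₀} = c ψ_{i₀}`; stripping the monomials
(`eq_of_X_pow_mul_eq_smul`) leaves `∏(1 - aX) ∏(1 - u_j q^{m_j} X) = c' ∏(1 - qaX) ∏(1 - u_j X)`,
and `blocks_trivial_of_prod_eq_smul` concludes.  Pure algebra; helper for the item (does not close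
it).

## References

* R. Godement, H. Jacquet, *Zeta functions of simple algebras*, LNM 260 (1972), Thm. 13.8.
  [GodementJacquet1972]
* J. Arthur, L. Clozel, Ann. of Math. Stud. 120 (1989), Ch. 3, Thm. 5.1. [ArthurClozelAMS120]
-/

set_option linter.dupNamespace false -- project-wide option (lakefile weak.linter.dupNamespace); `Summit.Langlands.Langlands` is the mandated namespace

open Polynomial Finset

namespace Summit.Langlands.Langlands.Theorems.SkinnerWilesDefectOne.StrongLiftingAllFinite

/-! ### Stripping monomials -/

/-- **Monomial stripping.**  If `X^A · P = c · X^B · Q` in `ℂ[X]` with `P(0) ≠ 0 ≠ Q(0)`, then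
`A = B` and `P = c · Q`. [folklore] -/
theorem eq_of_X_pow_mul_eq_smul {A B : ℕ} {P Q : ℂ[X]} {c : ℂ} (hP : P.eval 0 ≠ 0)
    (hQ : Q.eval 0 ≠ 0) (h : X ^ A * P = c • (X ^ B * Q)) : A = B ∧ P = c • Q := by
  have hX : (X : ℂ[X]) ≠ 0 := Polynomial.X_ne_zero
  rcases Nat.lt_trichotomy A B with hAB | rfl | hAB
  · exfalso
    obtain ⟨e, rfl⟩ := Nat.exists_eq_add_of_lt hAB
    have h1 : X ^ A * P = X ^ A * (c • (X ^ (e + 1) * Q)) := by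
      rw [h, show A + e + 1 = A + (e + 1) by ring, pow_add, mul_smul_comm, mul_assoc]
    have h2 : P = c • (X ^ (e + 1) * Q) := mul_left_cancel₀ (pow_ne_zero A hX) h1
    apply hP
    rw [h2, Polynomial.eval_smul, Polynomial.eval_mul, Polynomial.eval_pow, Polynomial.eval_X,
      zero_pow (Nat.succ_ne_zero e), zero_mul, smul_zero]
  · refine ⟨rfl, mul_left_cancel₀ (pow_ne_zero A hX) ?_⟩
    rw [h, mul_smul_comm]
  · exfalso
    obtain ⟨e, rfl⟩ := Nat.exists_eq_add_of_lt hAB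
    have h1 : X ^ B * (X ^ (e + 1) * P) = X ^ B * (c • Q) := by
      rw [mul_smul_comm, ← h, ← mul_assoc, ← pow_add, add_assoc]
    have h2 : X ^ (e + 1) * P = c • Q := mul_left_cancel₀ (pow_ne_zero B hX) h1
    have hc : c = 0 := by
      have h3 := congrArg (Polynomial.eval 0) h2
      rw [Polynomial.eval_mul, Polynomial.eval_pow, Polynomial.eval_X,
        zero_pow (Nat.succ_ne_zero e), zero_mul, Polynomial.eval_smul, smul_eq_mul] at h3
      exact (mul_eq_zero.mp h3.symm).resolve_right hQ
    rw [hc, zero_smul] at h2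
    have hP0 : P = 0 := (mul_eq_zero.mp h2).resolve_left (pow_ne_zero _ hX)
    exact hP (by rw [hP0, Polynomial.eval_zero])

/-! ### Evaluation of the cleared polynomials at the ramified prime -/

/-- `∏_{a ∈ α} (1 - g(a) X)` evaluated at `x` is `∏_{a ∈ α} (1 - g(a) x)`. [folklore] -/
theorem eval_prod_one_sub_C_mul_X (α : Multiset ℂ) (g : ℂ → ℂ) (x : ℂ) :
    Polynomial.eval x (α.map fun a => (1 - C (g a) * X : ℂ[X])).prod =
      (α.map fun a => 1 - g a * x).prod := by
  rw [Polynomial.eval_multiset_prod, Multiset.map_map]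
  exact congrArg Multiset.prod (Multiset.map_congr rfl fun a _ => by simp)

/-- `∏_j (1 - g_j X)` evaluated at `x`. [folklore] -/
theorem eval_finprod_one_sub_C_mul_X {J : Type*} [Fintype J] (g : J → ℂ) (x : ℂ) :
    Polynomial.eval x (∏ j, (1 - C (g j) * X : ℂ[X])) = ∏ j, (1 - g j * x) := by
  rw [Polynomial.eval_prod]
  exact Finset.prod_congr rfl fun j _ => by simp

/-- Clearing one dual factor: `(1 - y⁻¹) · (-y) = 1 - y` for `y ≠ 0`. [folklore] -/
theorem one_sub_inv_mul_neg {y : ℂ} (hy : y ≠ 0) : (1 - y⁻¹) * (-y) = 1 - y := by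
  have h1 : y⁻¹ * y = 1 := inv_mul_cancel₀ hy
  linear_combination h1

/-- Clearing the dual factors of the lift: `∏_j (1 - (w_j x)⁻¹) · ∏_j (-(w_j x)) = ∏_j (1 - w_j x)`
(`w_j x ≠ 0`). [folklore] -/
theorem prod_one_sub_inv_mul_prod_neg {J : Type*} [Fintype J] (w : J → ℂ) (x : ℂ)
    (hw : ∀ j, w j * x ≠ 0) :
    (∏ j, (1 - (w j * x)⁻¹)) * ∏ j, (-(w j * x)) = ∏ j, (1 - w j * x) := by
  rw [← Finset.prod_mul_distrib]
  exact Finset.prod_congr rfl fun j _ => one_sub_inv_mul_neg (hw j)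

/-- Clearing the dual factors of `π`: `∏_{a ∈ α} (1 - (a q x)⁻¹) · ∏_{a ∈ α} (-(a q x)) =
∏_{a ∈ α} (1 - q a x)` (`a q x ≠ 0`). [folklore] -/
theorem mprod_one_sub_inv_mul_mprod_neg (α : Multiset ℂ) (q x : ℂ) (h : ∀ a ∈ α, a * q * x ≠ 0) :
    (α.map fun a => 1 - (a * q * x)⁻¹).prod * (α.map fun a => -(a * q * x)).prod =
      (α.map fun a => 1 - q * a * x).prod := by
  rw [← Multiset.prod_map_mul]
  exact congrArg Multiset.prod (Multiset.map_congr rfl fun a ha => by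
    rw [one_sub_inv_mul_neg (h a ha)]
    ring)

/-- `∏_{a ∈ α} (-(a q x)) = (∏_{a ∈ α} (-(a q))) · x^{card α}`. [folklore] -/
theorem mprod_neg_mul (α : Multiset ℂ) (q x : ℂ) :
    (α.map fun a => -(a * q * x)).prod = (α.map fun a => -(a * q)).prod * x ^ Multiset.card α := by
  have : (fun a : ℂ => -(a * q * x)) = fun a => -(a * q) * x := by
    funext a; ring
  rw [this, Multiset.prod_map_mul, Multiset.map_const', Multiset.prod_replicate]

/-- `∏_j (-(w_j x)) = (∏_j (-w_j)) · x^{card J}`. [folklore] -/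
theorem prod_neg_mul {J : Type*} [Fintype J] (w : J → ℂ) (x : ℂ) :
    ∏ j, (-(w j * x)) = (∏ j, (-w j)) * x ^ Fintype.card J := by
  have : (fun j => -(w j * x)) = fun j => -w j * x := by
    funext j; ring
  rw [this, Finset.prod_mul_distrib, Finset.prod_const, Finset.card_univ]

/-! ### Evaluation points: a non-zero polynomial eventually does not vanish along `k ↦ r^k` -/

/-- **Eventual non-vanishing along a geometric progression.**  If `D ∈ ℂ[X]` is non-zero and
`0 < ‖r‖ < 1`, then `D(r^k) ≠ 0` for all large `k`: `k ↦ r^k` is injective (strictly decreasing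
moduli) and `D` has finitely many roots.  (Used to pass from an identity of meromorphic functions
to the identity at the integers `k ≥ k₀` that `prime_separation` consumes, with `r = p⁻¹`.)
[folklore] -/
theorem exists_forall_le_eval_pow_ne_zero {D : ℂ[X]} (hD : D ≠ 0) {r : ℂ} (hr0 : r ≠ 0)
    (hr1 : ‖r‖ < 1) : ∃ k₀ : ℕ, ∀ k, k₀ ≤ k → D.eval (r ^ k) ≠ 0 := by
  classical
  have hinj : Function.Injective fun k : ℕ => r ^ k := by
    have hanti : StrictAnti fun k : ℕ => ‖r ^ k‖ := by
      intro a b hab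
      simp only [norm_pow]
      exact pow_lt_pow_right_of_lt_one₀ (norm_pos_iff.mpr hr0) hr1 hab
    intro a b hab
    exact hanti.injective (by simp only [hab])
  have hfin : ((fun k : ℕ => r ^ k) ⁻¹' (↑D.roots.toFinset : Set ℂ)).Finite :=
    (D.roots.toFinset.finite_toSet).preimage hinj.injOn
  obtain ⟨k₀, hk₀⟩ := hfin.bddAbove
  refine ⟨k₀ + 1, fun k hk h0 => ?_⟩
  have hmem : k ∈ (fun k : ℕ => r ^ k) ⁻¹' (↑D.roots.toFinset : Set ℂ) := by
    simp only [Set.mem_preimage, Finset.mem_coe, Multiset.mem_toFinset]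
    exact (Polynomial.mem_roots hD).mpr h0
  have := hk₀ hmem
  omega

/-! ### The certificate -/

/-- **The ramified-clause certificate** (see the module docstring for the dictionary with the
L-function line).  Pairwise distinct primes `p_i`, a distinguished `i₀` with `q = p_{i₀}`; `α` a
multiset of non-zero complex numbers no two of which have ratio `q`; blocks `(u_j, m_j)` with
`u_j ≠ 0`, `m_j ≥ 1`; non-zero polynomials `G_i, G'_i` and exponents `d_i, d'_i` at the other
indices, exponents `e₀, e₀'` and a constant `c₁`.  If for every `k ≥ k₀`, with `x_i = p_i^{-k}`,
`∏_{a ∈ α}(1 - a x₀) ∏_j (1 - (u_j q^{m_j} x₀)⁻¹) x₀^{e₀} ∏_{i ≠ i₀} G_i(x_i) (x_i^{d_i})⁻¹ =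
c₁ ∏_{a ∈ α}(1 - (a q x₀)⁻¹) ∏_j (1 - u_j x₀) x₀^{e₀'} ∏_{i ≠ i₀} G'_i(x_i) (x_i^{d'_i})⁻¹`, then
every `m_j = 1` and `α = {u_j}_j`. [folklore] -/
theorem ramified_clause_certificate {ι J : Type*} [Fintype ι] [DecidableEq ι] [Fintype J]
    (p : ι → ℕ) (hp : ∀ i, (p i).Prime) (hinj : Function.Injective p) (i₀ : ι)
    (α : Multiset ℂ) (hα : (0 : ℂ) ∉ α) (hgen : ∀ a ∈ α, ∀ b ∈ α, b ≠ (p i₀ : ℂ) * a)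
    (u : J → ℂ) (m : J → ℕ) (hu : ∀ j, u j ≠ 0) (hm : ∀ j, 1 ≤ m j)
    (G G' : ι → ℂ[X]) (hG : ∀ i, G i ≠ 0) (hG' : ∀ i, G' i ≠ 0) (d d' : ι → ℕ)
    (e₀ e₀' : ℕ) (c₁ : ℂ) (k₀ : ℕ)
    (h : ∀ k, k₀ ≤ k →
      (α.map fun a => 1 - a * ((p i₀ : ℂ))⁻¹ ^ k).prod *
          (∏ j, (1 - (u j * (p i₀ : ℂ) ^ m j * ((p i₀ : ℂ))⁻¹ ^ k)⁻¹)) *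
          (((p i₀ : ℂ))⁻¹ ^ k) ^ e₀ *
          ∏ i ∈ Finset.univ.erase i₀,
            (G i).eval (((p i : ℂ))⁻¹ ^ k) * ((((p i : ℂ))⁻¹ ^ k) ^ d i)⁻¹ =
        c₁ * (α.map fun a => 1 - (a * (p i₀ : ℂ) * ((p i₀ : ℂ))⁻¹ ^ k)⁻¹).prod *
          (∏ j, (1 - u j * ((p i₀ : ℂ))⁻¹ ^ k)) *
          (((p i₀ : ℂ))⁻¹ ^ k) ^ e₀' *
          ∏ i ∈ Finset.univ.erase i₀,
            (G' i).eval (((p i : ℂ))⁻¹ ^ k) * ((((p i : ℂ))⁻¹ ^ k) ^ d' i)⁻¹) :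
    (∀ j, m j = 1) ∧ α = ∑ j, ({u j} : Multiset ℂ) := by
  classical
  -- the ramified prime as a complex number
  have hq1 : 1 < ‖((p i₀ : ℂ))‖ := by
    rw [Complex.norm_natCast]
    exact_mod_cast (hp i₀).one_lt
  have hp0 : ∀ i, ((p i : ℂ)) ≠ 0 := fun i => by exact_mod_cast (hp i).ne_zero
  have hq0 : ((p i₀ : ℂ)) ≠ 0 := hp0 i₀
  have hx0 : ∀ i (k : ℕ), ((p i : ℂ))⁻¹ ^ k ≠ 0 := fun i k => pow_ne_zero _ (inv_ne_zero (hp0 i))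
  have hw0 : ∀ j, u j * (p i₀ : ℂ) ^ m j ≠ 0 := fun j => mul_ne_zero (hu j) (pow_ne_zero _ hq0)
  have ha0 : ∀ a ∈ α, a ≠ 0 := fun a ha h0 => hα (h0 ▸ ha)
  -- the constants produced by clearing the inverses
  set κa : ℂ := (α.map fun a => -(a * (p i₀ : ℂ))).prod with hκa
  set κw : ℂ := ∏ j, (-(u j * (p i₀ : ℂ) ^ m j)) with hκw
  have hκa0 : κa ≠ 0 := by
    rw [hκa]
    refine Multiset.prod_ne_zero fun h0 => ?_
    obtain ⟨a, ha, h1⟩ := Multiset.mem_map.mp h0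
    exact mul_ne_zero (ha0 a ha) hq0 (neg_eq_zero.mp h1)
  have hκw0 : κw ≠ 0 := Finset.prod_ne_zero_iff.mpr fun j _ => neg_ne_zero.mpr (hw0 j)
  -- the cleared polynomials at `i₀`
  set P₁ : ℂ[X] := (α.map fun a => (1 - C a * X : ℂ[X])).prod with hP₁
  set Pw : ℂ[X] := ∏ j, (1 - C (u j * (p i₀ : ℂ) ^ m j) * X : ℂ[X]) with hPw
  set P₁' : ℂ[X] := (α.map fun a => (1 - C ((p i₀ : ℂ) * a) * X : ℂ[X])).prod with hP₁'
  set Pu : ℂ[X] := ∏ j, (1 - C (u j) * X : ℂ[X]) with hPu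
  set Φ₀ : ℂ[X] := X ^ (Multiset.card α + e₀) * (P₁ * Pw) * C κa with hΦ₀
  set Ψ₀ : ℂ[X] := X ^ (Fintype.card J + e₀') * (P₁' * Pu) * C κw with hΨ₀
  have hP₁ev : Polynomial.eval 0 (P₁ * Pw) ≠ 0 := by
    rw [hP₁, hPw, Polynomial.eval_mul, eval_prod_one_sub_C_mul_X, eval_finprod_one_sub_C_mul_X]
    simp
  have hP₁'ev : Polynomial.eval 0 (P₁' * Pu) ≠ 0 := by
    rw [hP₁', hPu, Polynomial.eval_mul, eval_prod_one_sub_C_mul_X, eval_finprod_one_sub_C_mul_X]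
    simp
  have hΦ₀0 : Φ₀ ≠ 0 := by
    rw [hΦ₀]
    refine mul_ne_zero (mul_ne_zero (pow_ne_zero _ Polynomial.X_ne_zero) ?_) (C_ne_zero.mpr hκa0)
    intro h0
    exact hP₁ev (by rw [h0, Polynomial.eval_zero])
  have hΨ₀0 : Ψ₀ ≠ 0 := by
    rw [hΨ₀]
    refine mul_ne_zero (mul_ne_zero (pow_ne_zero _ Polynomial.X_ne_zero) ?_) (C_ne_zero.mpr hκw0)
    intro h0
    exact hP₁'ev (by rw [h0, Polynomial.eval_zero])
  -- the two families of polynomials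
  let φ : ι → ℂ[X] := fun i => if i = i₀ then Φ₀ else G i * X ^ d' i
  let ψ : ι → ℂ[X] := fun i => if i = i₀ then Ψ₀ else G' i * X ^ d i
  have hφi₀ : φ i₀ = Φ₀ := if_pos rfl
  have hψi₀ : ψ i₀ = Ψ₀ := if_pos rfl
  have hφi : ∀ i, i ≠ i₀ → φ i = G i * X ^ d' i := fun i hi => if_neg hi
  have hψi : ∀ i, i ≠ i₀ → ψ i = G' i * X ^ d i := fun i hi => if_neg hi
  have hφ0 : ∀ i, φ i ≠ 0 := by
    intro i
    by_cases hi : i = i₀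
    · rw [hi, hφi₀]; exact hΦ₀0
    · rw [hφi i hi]; exact mul_ne_zero (hG i) (pow_ne_zero _ Polynomial.X_ne_zero)
  have hψ0 : ∀ i, ψ i ≠ 0 := by
    intro i
    by_cases hi : i = i₀
    · rw [hi, hψi₀]; exact hΨ₀0
    · rw [hψi i hi]; exact mul_ne_zero (hG' i) (pow_ne_zero _ Polynomial.X_ne_zero)
  -- evaluations at `i₀`
  have hevΦ₀ : ∀ x : ℂ, Φ₀.eval x = x ^ (Multiset.card α + e₀) *
      ((α.map fun a => 1 - a * x).prod * ∏ j, (1 - u j * (p i₀ : ℂ) ^ m j * x)) * κa := by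
    intro x
    rw [hΦ₀, Polynomial.eval_mul, Polynomial.eval_mul, Polynomial.eval_pow, Polynomial.eval_X,
      Polynomial.eval_C, Polynomial.eval_mul, hP₁, hPw, eval_prod_one_sub_C_mul_X,
      eval_finprod_one_sub_C_mul_X]
  have hevΨ₀ : ∀ x : ℂ, Ψ₀.eval x = x ^ (Fintype.card J + e₀') *
      ((α.map fun a => 1 - (p i₀ : ℂ) * a * x).prod * ∏ j, (1 - u j * x)) * κw := by
    intro x
    rw [hΨ₀, Polynomial.eval_mul, Polynomial.eval_mul, Polynomial.eval_pow, Polynomial.eval_X,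
      Polynomial.eval_C, Polynomial.eval_mul, hP₁', hPu, eval_prod_one_sub_C_mul_X,
      eval_finprod_one_sub_C_mul_X]
  -- the polynomial identity at the integers `k ≥ k₀`
  have hpoly : ∀ k, k₀ ≤ k →
      ∏ i, (φ i).eval (((p i : ℂ))⁻¹ ^ k) = c₁ * ∏ i, (ψ i).eval (((p i : ℂ))⁻¹ ^ k) := by
    intro k hk
    have hk' := h k hk
    -- split off `i₀` and evaluate
    rw [← Finset.mul_prod_erase Finset.univ (fun i => (φ i).eval (((p i : ℂ))⁻¹ ^ k))
        (Finset.mem_univ i₀),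
      ← Finset.mul_prod_erase Finset.univ (fun i => (ψ i).eval (((p i : ℂ))⁻¹ ^ k))
        (Finset.mem_univ i₀)]
    have hEφ : ∏ i ∈ Finset.univ.erase i₀, (φ i).eval (((p i : ℂ))⁻¹ ^ k) =
        (∏ i ∈ Finset.univ.erase i₀,
          (G i).eval (((p i : ℂ))⁻¹ ^ k) * ((((p i : ℂ))⁻¹ ^ k) ^ d i)⁻¹) *
        ∏ i ∈ Finset.univ.erase i₀, (((p i : ℂ))⁻¹ ^ k) ^ (d i + d' i) := by
      rw [← Finset.prod_mul_distrib]
      refine Finset.prod_congr rfl fun i hi => ?_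
      rw [hφi i (Finset.ne_of_mem_erase hi), Polynomial.eval_mul, Polynomial.eval_pow,
        Polynomial.eval_X, pow_add, mul_assoc, inv_mul_cancel_left₀ (pow_ne_zero _ (hx0 i k))]
    have hEψ : ∏ i ∈ Finset.univ.erase i₀, (ψ i).eval (((p i : ℂ))⁻¹ ^ k) =
        (∏ i ∈ Finset.univ.erase i₀,
          (G' i).eval (((p i : ℂ))⁻¹ ^ k) * ((((p i : ℂ))⁻¹ ^ k) ^ d' i)⁻¹) *
        ∏ i ∈ Finset.univ.erase i₀, (((p i : ℂ))⁻¹ ^ k) ^ (d i + d' i) := by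
      rw [← Finset.prod_mul_distrib]
      refine Finset.prod_congr rfl fun i hi => ?_
      rw [hψi i (Finset.ne_of_mem_erase hi), Polynomial.eval_mul, Polynomial.eval_pow,
        Polynomial.eval_X, add_comm (d i) (d' i), pow_add, mul_assoc,
        inv_mul_cancel_left₀ (pow_ne_zero _ (hx0 i k))]
    rw [hφi₀, hψi₀, hEφ, hEψ, hevΦ₀, hevΨ₀]
    -- abstract the value `x₀ = q^{-k}` at the ramified prime
    have hx₀0 : ((p i₀ : ℂ))⁻¹ ^ k ≠ 0 := hx0 i₀ k
    generalize hx₀ : ((p i₀ : ℂ))⁻¹ ^ k = x₀ at hk' hx₀0 ⊢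
    -- clear the inverses at `i₀`
    have hJ : ∏ j, (1 - u j * (p i₀ : ℂ) ^ m j * x₀) =
        (∏ j, (1 - (u j * (p i₀ : ℂ) ^ m j * x₀)⁻¹)) * (κw * x₀ ^ Fintype.card J) := by
      rw [hκw, ← prod_neg_mul (fun j => u j * (p i₀ : ℂ) ^ m j) x₀,
        prod_one_sub_inv_mul_prod_neg (fun j => u j * (p i₀ : ℂ) ^ m j) x₀
          fun j => mul_ne_zero (hw0 j) hx₀0]
    have hA : (α.map fun a => 1 - (p i₀ : ℂ) * a * x₀).prod =
        (α.map fun a => 1 - (a * (p i₀ : ℂ) * x₀)⁻¹).prod * (κa * x₀ ^ Multiset.card α) := by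
      rw [hκa, ← mprod_neg_mul, mprod_one_sub_inv_mul_mprod_neg α (p i₀ : ℂ) x₀ fun a ha =>
        mul_ne_zero (mul_ne_zero (ha0 a ha) hq0) hx₀0]
    rw [hJ, hA]
    linear_combination
      (κa * κw * x₀ ^ (Multiset.card α + Fintype.card J) *
        ∏ i ∈ Finset.univ.erase i₀, (((p i : ℂ))⁻¹ ^ k) ^ (d i + d' i)) * hk'
  -- prime separation isolates `i₀`
  obtain ⟨c, hc, -⟩ := prime_separation p hp hinj φ ψ hφ0 hψ0 c₁ k₀ hpoly
  obtain ⟨-, hcφ⟩ := hc i₀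
  have hΦΨ : Φ₀ = c i₀ • Ψ₀ := by rwa [hφi₀, hψi₀] at hcφ
  -- strip the monomials and the constants
  have hstrip : X ^ (Multiset.card α + e₀) * (P₁ * Pw) =
      (c i₀ * κw / κa) • (X ^ (Fintype.card J + e₀') * (P₁' * Pu)) := by
    have h1 : X ^ (Multiset.card α + e₀) * (P₁ * Pw) = Φ₀ * C κa⁻¹ := by
      rw [hΦ₀, mul_assoc (X ^ (Multiset.card α + e₀) * (P₁ * Pw)), ← C_mul,
        mul_inv_cancel₀ hκa0, C_1, mul_one]
    rw [h1, hΦΨ, hΨ₀, smul_eq_C_mul, smul_eq_C_mul, div_eq_mul_inv, C_mul, C_mul]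
    ring
  obtain ⟨-, hPP⟩ := eq_of_X_pow_mul_eq_smul hP₁ev hP₁'ev hstrip
  -- single-prime rigidity
  obtain ⟨-, hm1, hαu⟩ := blocks_trivial_of_prod_eq_smul hq1 hα hgen u m hu hm (c i₀ * κw / κa)
    (by rw [hP₁, hPw, hP₁', hPu] at hPP; exact hPP)
  exact ⟨hm1, hαu⟩

end Summit.Langlands.Langlands.Theorems.SkinnerWilesDefectOne.StrongLiftingAllFinite
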